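import Literature.AlgebraicGeometry.HodgeTheory.ComplexGysinCorrespondence
import Literature.AlgebraicGeometry.HodgeTheory.AbelianVarietyMultiplicationPullback
import Literature.AlgebraicGeometry.HodgeTheory.MotivatedClassesAlgebraic
import Literature.AlgebraicGeometry.HodgeTheory.ComplexOrientationFamily
import Mathlib.LinearAlgebra.Vandermonde
import Mathlib.LinearAlgebra.Matrix.NonsingularInverse
import HarnessLib

/-!
# Ring 2 · sub-cell AbelianAll, André axis, part XXII-f — GROTHENDIECK'S KÜNNETH STANDARD CONJECTURE `C(A)` FOR
# COMPLEX ABELIAN VARIETIES ON THE REAL CARRIERS: the Künneth projectors are ONE algebraic class each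

HONEST FRAMING (page 1, verbatim): **research route, not a corollary; conditional on HC_CM plus one named
minimal statement.** Cell line: research route conditional on HC_CM; not a corollary; Q11.4-sentence-2
already refuted in dim ≥ 3. Nothing in this file proves a case of the Hodge conjecture; `HC_CM` does not occur.
Seat `pub-hodge-ring2-ab-andre-2`, gen 14; companion of the Lieberman discharge (parts XXII-a–e): the other classical
standard conjecture known for abelian varieties, Grothendieck's `C(A)` (Kleiman 1968 §2, 2A; Kleiman 1994 4.1: "for an
abelian variety the Künneth components of the diagonal are algebraic, because `n_A^* = n^i` on `Hⁱ(A)`"), proved on the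
real carriers: for every complex abelian variety `A` of dimension `g` and every `k` there is ONE algebraic class
`π_k ∈ Nᵍ H^{2g}((A × A)(ℂ); ℂ)` whose correspondence action on `Hᵃ(A(ℂ); ℂ)` is the identity for `a = k` and zero for
every other `a ≤ 2g`.

## The argument

The graph class `[Γ_{[n]}]` of multiplication by `n` is algebraic and acts as `[n]^*` in EVERY degree (the tree's
`complexGysin_graph_one_mem_algebraicClasses`, `corrClassAction_graph`), and `[n]^* = nᵃ` on `Hᵃ(A(ℂ); ℂ)` (the tree's
theorem `complexBetti_map_nsmul_id_apply`, from `H•(A(ℂ)) = ⋀•H¹`). The Vandermonde matrix of the `2g + 1` distinct nodes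
`n = 0, …, 2g` is invertible (Mathlib `Matrix.det_vandermonde_ne_zero_iff`), so there are `c_{k,0}, …, c_{k,2g} ∈ ℂ` with
`Σ_n c_{k,n} nᵃ = δ_{ak}` for all `a ≤ 2g`; `π_k := Σ_n c_{k,n} [Γ_{[n]}]`.

## What is proved (theorems only; no definition, no named fact, no sorry)

§1 `exists_vandermonde_solution` (linear algebra); §2 `corrAction_graph_nsmul` (`[Γ_{[n]}]_* = nᵃ` on `Hᵃ`);
§3 **`exists_kunnethProjector_abelianVariety`**. EDGE LABELS: all K. References: Kleiman1968AlgebraicCycles (§2, App. 2A);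
Kleiman1994 (4.1); Grothendieck1968 (§3); MumfordAV1970 (§1 (3), §19); Andre1996Motifs (§2.1 p. 15); LangeBirkenhake1992
(Lemma 1.1.17).
-/

noncomputable section

set_option linter.dupNamespace false

namespace Summit.HodgeConjecture.HodgeConjecture.Ring2.AbelianAll

open CategoryTheory AlgebraicGeometry MonoidalCategory CartesianMonoidalCategory
open Literature.AlgebraicGeometry Literature.AlgebraicGeometry.Motives
open Literature.AlgebraicGeometry.HodgeTheory
open Literature.AlgebraicTopology.SingularHomology (singularCohomology cupProduct)

/-! ## §1 The Vandermonde system `Σ_n c_n nᵃ = δ_{ak}` -/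

/-- **Interpolation of `δ_{·k}` on the nodes `0, …, N` by powers**: there are `c₀, …, c_N ∈ ℂ` with `Σ_{n ≤ N} c_n nᵃ = δ_{ak}` for all
`a ≤ N` (the transposed Vandermonde matrix of the distinct nodes `0, …, N` is invertible). [folklore] -/
theorem exists_vandermonde_solution (N k : ℕ) :
    ∃ c : Fin (N + 1) → ℂ, ∀ a : ℕ, a ≤ N →
      ∑ i : Fin (N + 1), c i * ((i : ℕ) : ℂ) ^ a = if a = k then 1 else 0 := by
  classical
  by_cases hk : k ≤ N
  · -- the Vandermonde matrix of the nodes `0, …, N`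
    set v : Fin (N + 1) → ℂ := fun i ↦ ((i : ℕ) : ℂ) with hv
    set V : Matrix (Fin (N + 1)) (Fin (N + 1)) ℂ := (Matrix.vandermonde v).transpose with hV
    have hdet : IsUnit V.det := by
      rw [hV, Matrix.det_transpose, isUnit_iff_ne_zero, Matrix.det_vandermonde_ne_zero_iff]
      intro i j hij
      have h' : ((i : ℕ) : ℂ) = ((j : ℕ) : ℂ) := hij
      exact Fin.ext (Nat.cast_injective h')
    set e : Fin (N + 1) → ℂ := Pi.single (⟨k, by omega⟩ : Fin (N + 1)) 1 with he
    refine ⟨V⁻¹.mulVec e, fun a ha ↦ ?_⟩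
    have hsol : V.mulVec (V⁻¹.mulVec e) = e := by
      rw [Matrix.mulVec_mulVec, Matrix.mul_nonsing_inv _ hdet, Matrix.one_mulVec]
    have hrow := congrFun hsol ⟨a, by omega⟩
    rw [Matrix.mulVec, dotProduct] at hrow
    calc ∑ i : Fin (N + 1), V⁻¹.mulVec e i * ((i : ℕ) : ℂ) ^ a
        = ∑ i : Fin (N + 1), V ⟨a, by omega⟩ i * V⁻¹.mulVec e i := by
          refine Finset.sum_congr rfl fun i _ ↦ ?_
          rw [hV, Matrix.transpose_apply, Matrix.vandermonde_apply, mul_comm]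
      _ = e ⟨a, by omega⟩ := hrow
      _ = if a = k then 1 else 0 := by
          rw [he, Pi.single_apply]
          simp only [Fin.mk.injEq]
  · refine ⟨0, fun a ha ↦ ?_⟩
    have hak : a ≠ k := by omega
    simp [hak]

/-! ## §2 The graph of multiplication by `n` acts as `nᵃ` on `Hᵃ(A(ℂ); ℂ)` -/

/-- **`[Γ_{[n]}]_* = nᵃ · id` on `Hᵃ(A(ℂ); ℂ)`**: the (algebraic) graph class of multiplication by `n` on a complex abelian
variety acts as `[n]^*` (the tree's `corrClassAction_graph`), and `[n]^* = nᵃ` on `Hᵃ` (`complexBetti_map_nsmul_id_apply`,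
Mumford §1 (3) / §19). [cite: MumfordAV1970, §1 (3) and §19] [cite: Andre1996Motifs, §2.1 (p. 15)] -/
theorem corrAction_graph_nsmul (A : AbelianVariety ℂ) (n a : ℕ) (ha : a ≤ 2 * A.dim) :
    corrAction complexOrientationFamily (AbelianVariety.isSmoothProjective_holds (A := A))
        (AbelianVariety.isSmoothProjective_holds (A := A)) (rfl : a + 2 * A.dim = a + 2 * A.dim)
        (complexGysin complexOrientationFamily (AbelianVariety.isSmoothProjective_holds (A := A))
          ((AbelianVariety.isSmoothProjective_holds (A := A)).tensor_holds (AbelianVariety.isSmoothProjective_holds (A := A)))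
          (lift (𝟙 A.X) (n • 𝟙 A).hom.hom.hom) (show 0 + 2 * (A.dim + A.dim) = 2 * A.dim + 2 * A.dim by omega)
          (singularCohomology.one ℂ (ComplexPoints A.X))) =
      (((n : ℂ)) ^ a) • LinearMap.id := by
  have hA : IsSmoothProjective A.dim A.X := AbelianVariety.isSmoothProjective_holds (A := A)
  refine LinearMap.ext fun c ↦ ?_
  rw [corrAction_eq_corrClassAction complexOrientationFamily hA hA rfl (show a + (2 * A.dim - a) = 2 * A.dim by omega),
    corrClassAction_graph complexOrientationFamily hasPoincareDuality_complexOrientationFamily hA (hA.tensor_holds hA)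
      (n • 𝟙 A).hom.hom.hom (show a + (2 * A.dim - a) = 2 * A.dim by omega) c,
    LinearMap.smul_apply, LinearMap.id_apply]
  exact complexBetti_map_nsmul_id_apply A n a c

/-! ## §3 The Künneth projectors are algebraic -/

/-- **KÜNNETH STANDARD CONJECTURE `C(A)` FOR COMPLEX ABELIAN VARIETIES, on the real carriers** (Kleiman 1968 §2 / 2A;
Kleiman 1994 4.1): for every complex abelian variety `A` of dimension `g` and every `k`, there is ONE algebraic class
`π_k ∈ Nᵍ H^{2g}((A × A)(ℂ); ℂ)` — `π_k = Σ_{n ≤ 2g} c_{k,n} [Γ_{[n]}]`, Vandermonde coefficients — whose correspondence action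
on `Hᵃ(A(ℂ); ℂ)` is `δ_{ak} · id` for every `a ≤ 2g`: the `k`-th Künneth component of the diagonal is algebraic.
[cite: Kleiman1968AlgebraicCycles, §2 and Appendix 2A] [cite: Kleiman1994, 4.1] [cite: MumfordAV1970, §19] -/
theorem exists_kunnethProjector_abelianVariety (A : AbelianVariety ℂ) (k : ℕ) :
    ∃ π ∈ algebraicClasses (A.X ⊗ A.X) A.dim, ∀ a : ℕ, a ≤ 2 * A.dim →
      corrAction complexOrientationFamily (AbelianVariety.isSmoothProjective_holds (A := A))
        (AbelianVariety.isSmoothProjective_holds (A := A)) (rfl : a + 2 * A.dim = a + 2 * A.dim) π =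
      (if a = k then (1 : ℂ) else 0) • LinearMap.id := by
  classical
  have hA : IsSmoothProjective A.dim A.X := AbelianVariety.isSmoothProjective_holds (A := A)
  obtain ⟨c, hc⟩ := exists_vandermonde_solution (2 * A.dim) k
  -- the graph classes of `[n]`, `n = 0, …, 2g`
  set Γ : Fin (2 * A.dim + 1) → complexBetti (A.X ⊗ A.X) (2 * A.dim) := fun i ↦
    complexGysin complexOrientationFamily hA (hA.tensor_holds hA) (lift (𝟙 A.X) ((i : ℕ) • 𝟙 A).hom.hom.hom)
      (show 0 + 2 * (A.dim + A.dim) = 2 * A.dim + 2 * A.dim by omega) (singularCohomology.one ℂ (ComplexPoints A.X))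
    with hΓ
  refine ⟨∑ i, c i • Γ i, Submodule.sum_mem _ fun i _ ↦ Submodule.smul_mem _ _ ?_, fun a ha ↦ ?_⟩
  · exact complexGysin_graph_one_mem_algebraicClasses complexOrientationFamily hasPoincareDuality_complexOrientationFamily hA
      (hA.tensor_holds hA) _
  · rw [map_sum]
    simp only [map_smul, hΓ]
    rw [show (∑ i : Fin (2 * A.dim + 1), c i • corrAction complexOrientationFamily hA hA (rfl : a + 2 * A.dim = a + 2 * A.dim)
        (complexGysin complexOrientationFamily hA (hA.tensor_holds hA) (lift (𝟙 A.X) ((i : ℕ) • 𝟙 A).hom.hom.hom)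
          (show 0 + 2 * (A.dim + A.dim) = 2 * A.dim + 2 * A.dim by omega) (singularCohomology.one ℂ (ComplexPoints A.X)))) =
        ∑ i : Fin (2 * A.dim + 1), (c i * ((i : ℕ) : ℂ) ^ a) • (LinearMap.id : complexBetti A.X a →ₗ[ℂ] complexBetti A.X a)
      from Finset.sum_congr rfl fun i _ ↦ by rw [corrAction_graph_nsmul A i a ha, smul_smul]]
    rw [← Finset.sum_smul, hc a ha]

end Summit.HodgeConjecture.HodgeConjecture.Ring2.AbelianAll

end
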